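import Literature.MathematicalPhysics.QuantumFieldTheory.Balaban1983to89.B9Thm313WholeL2GPZ

/-!
# `Balaban1983to89.B9Thm313WholeL2DerivCut` — [B9] Theorem 3.13 (p. 426), THE SECOND-ORDER block-L² LINES (3.46)₄∕₅ OF 𝔊 WITHOUT THE
# THIRD-ORDER LETTERS `Letters313L2PZ.ddGDv ∕ rgdDds`: the middle term of (3.153) re-associated so that the cut falls on the ORDER-ZERO words
# D·R·D\*·G₁ (left lines) and G₁·D·R·D\* (right lines) instead of on E·G₀·D ∕ R·D\*·G₁·F with three derivatives

T. Bałaban, *Propagators for lattice gauge theories in a background field*, Commun. Math. Phys. **99** (1985) 389–434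
[`Balaban1985BackgroundPropagators`, "B9"]; [4] = T. Bałaban, *Propagators and renormalization transformations for lattice gauge
theories. II*, Commun. Math. Phys. **96** (1984) 223–250 [`Balaban1984PropagatorsII`].

statement-level skeleton of published theorems with citation tags; proofs where landed; nothing here is a claim about the Yang–Mills mass gap

THE PRINTED LOCUS (held text `paper:balaban1985-cmp99-background-propagators`).  (3.46) p. 398: the SIX block-L² lines of Theorem 3.1 ∕ 3.3 —
‖1_{Δ(y)}Gλ‖, ‖1_{Δ(y)}∇_UGλ‖, ‖1_{Δ(y)}G∇\*_Uλ‖, ‖1_{Δ(y)}∇_UG∇\*_Uλ‖, ‖1_{Δ(y)}∇_U∇_UGλ‖, ‖1_{Δ(y)}G∇\*_U∇\*_Uλ‖ with prefactors [(Lʲη)², Lʲη, Lʲη, 1, 1, 1]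
(typed `B9.pref6`; total derivative order ≦ 2 — there is NO third-order line); p. 398 (remark after (3.47): the powers may be split between the
two localisations); p. 426, (3.153): *"𝔊 = G₁ − G₁DRD\*G₁ − G₁Q\*(QG₁Q\*)⁻¹QG₁ = G₁𝔓\* = 𝔓G₁"* and Theorem 3.13 (Theorem 3.3 for 𝔊 except the Laplacian line).

THE POINT (cell `pub/ym-inputs` seat p04, LOCATE memo `LETTERS-313-LOCATE-p04.md` §2 (L2)–(L3)).  `B9Thm313WholeL2GPZ.GG_l2bd_leftZ ∕ rightZ` (and the
pair families `B9Thm313WholeDirL2Z.GG_l2bd_family3Z ∕ 5Z`) cut the middle term of (3.153) as (E·G₁·D)∘(R·D\*·G₁) resp. (G₁·D)∘(R·D\*·G₁·F), i.e.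
through `Letters313L2PZ.ddGDv` (E·G₀·D, three derivatives, factor (Lʲη)⁻¹) and `.rgdDds` (R·D\*·G₁·F, three derivatives, factor (L^{j′}η)⁻¹) — words of
net order +1 in PLAIN block-L², not among print's lines and without a member-uniform supplier at genuine operators (a lattice-scale oscillation costs
η⁻¹, not (Lʲη)⁻¹).  Re-associating the SAME term, E·G₁·D·R·D\*·G₁ = (E·G₁)∘(D·R·D\*·G₁) and G₁·D·R·D\*·G₁·F = (G₁·D·R·D\*)∘(G₁·F), cuts it at
ORDER-ZERO words: E·G₁ ∕ G₁·F are the (3.46)₄∕₅ lines for G₁ that the proof already derives (`entry_l2w_of_step`), and V := D·R·D\*·G₁,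
V′ := G₁·D·R·D\* are order-zero words (species: (3.46)₃ for G′ via (3.152), (3.49) for R = ϱ(I − P)).  THIS FILE types the re-associated lines,
statement shapes VERBATIM those of the `…Z` lemmas, with `hEGDv ∕ hrgdF` (and the then-unused `gDv ∕ rgdI`) replaced by ONE order-zero letter each:
* §1 `E_GG_eq_derivCut`, `GG_comp_eq_derivCut` — (3.153) with a left ∕ right factor, middle term re-associated (pure algebra);
* §2 ★★ `GG_l2bd_leftDerivCut` (generic E; `hE3`, `hEGQs`, coarse letters `gQs ∕ c1 ∕ q` in the `Letters313L2PZ` shapes, `hV : BlockBd blk blk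
  (D∘R∘D\*∘G₁) (B₄·(L^{j′}η∕Lʲη)·e^{−δd})`), ★★ `GG_l2bd_rightDerivCut` (generic F; `hF5`, coarse letters, `hV' : BlockBd blk blk (G₁∘D∘R∘D\*)
  (B₄·(Lʲη∕L^{j′}η)·e^{−δd})`); same constants `constG46 (constKp B₂ B₄ θ c) c`·Λ, same provisos;
* §3 ★ `GG_l2bd_family3DerivCut`, ★ `GG_l2bd_family5DerivCut` — the pair families over `Thm33G0L2P.l3 ∕ l5`, `ddGQs`, `hV ∕ hV'` (NO `ddGDv ∕ rgdDds`).

HONEST SCOPE.  Kernel bookkeeping over landed schemas: two displayed third-order letters are REPLACED by two order-zero letters of printed species,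
not discharged; nothing of [B9]'s estimates is asserted; COUNT-NEUTRAL; N06 NOT discharged; whether the certificate's `hLL2` ∕ the T³ row adopt this cut
is their owners' call (dag-n06-d ∕ dag-n06-l; ★★OWNER ym3-torus-plan).  One finite lattice at a time; nothing continuum, nothing about the mass gap ∕
Clay.  Seat `ym-inputs-p04` (prover-ym-inputs-p04-0), 2026-08-28; NEW file.
-/

namespace Literature.MathematicalPhysics.QuantumFieldTheory.Balaban1983to89.B9Thm313WholeL2DerivCut

open Literature.MathematicalPhysics.QuantumFieldTheory.Balaban1983to89
open Finset B6RandomWalk B6RandomWalkHom B9Thm34Ext B9Thm37GlueCor36 B11SectG B9SectDSup B9SectDL2Decay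
open B9Thm37AllNorms B9Thm37AllNormsInstances B9Thm312Whole B9Thm312WholeLeaf B9Thm312WholeLeft B9Thm313Whole B9Thm313WholeLeft B9Ineq347
open B9Thm312WholeClasses B9Thm312WholeL2 B9Thm313WholeHolder B9Thm313WholeL2G B9Thm312WholeBlocksNbr B9RWSums346SecondDiff B9Thm313WholeL2GP B9Thm313WholeL2GZ
open B9Thm313WholeL2GPZ

noncomputable section

section L2

variable {g : B9.Geometry} {B : B9.Backgrounds} {X Y Z W P : Type} [Fintype X] [Fintype Y] [Fintype Z] [Fintype W]
  [Fintype g.Site]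
variable {R₀ : ℝ} {H₀ : Prop}

/-! ## §1 (3.153) with a left ∕ right factor, middle term re-associated -/

omit [Fintype Y] [Fintype g.Site] in
/-- **(3.153) WITH A LEFT FACTOR E, MIDDLE TERM RE-ASSOCIATED**: E𝔊 = EG₁ − (EG₁)(DRD\*G₁) − (EG₁Q\*)((QG₁Q\*)⁻¹(QG₁)) from 𝔊 = G₁𝔓\* (`Identities.eq153`;
the re-association of `B9Thm313WholeHolder.E_GG_eq`). [cite: Balaban1985BackgroundPropagators, (3.153) p.426] -/
theorem E_GG_eq_derivCut {V' : Type} {𝔬 : Ops g B X Y Z W} {U : B.Cfg} (hI : Identities 𝔬 U) (E : (X → ℝ) →ₗ[ℝ] (V' → ℝ)) :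
    E ∘ₗ 𝔬.GG U =
      E ∘ₗ 𝔬.G1 U ∘ₗ LinearMap.id -
        (E ∘ₗ 𝔬.G1 U ∘ₗ LinearMap.id) ∘ₗ (𝔬.Dv U ∘ₗ 𝔬.R U ∘ₗ 𝔬.Dvstar U ∘ₗ 𝔬.G1 U) -
        (E ∘ₗ 𝔬.G1 U ∘ₗ 𝔬.Qstar U) ∘ₗ (𝔬.C1 U ∘ₗ (𝔬.Q U ∘ₗ (𝔬.G1 U ∘ₗ LinearMap.id))) := by
  refine LinearMap.ext fun f => ?_
  simp only [LinearMap.comp_apply, LinearMap.sub_apply, LinearMap.id_coe, id_eq, hI.eq153, frakPstar_apply, map_sub]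
  abel

omit [Fintype Y] [Fintype g.Site] in
/-- **(3.153) WITH A RIGHT FACTOR F, MIDDLE TERM RE-ASSOCIATED**: 𝔊F = G₁F − (G₁DRD\*)(G₁F) − (G₁Q\*)((QG₁Q\*)⁻¹(Q(G₁F))) (the re-association of
`B9Thm313Whole.GG_comp_eq`). [cite: Balaban1985BackgroundPropagators, (3.153) p.426] -/
theorem GG_comp_eq_derivCut {V : Type} {𝔬 : Ops g B X Y Z W} {U : B.Cfg} (hI : Identities 𝔬 U) (Fop : (V → ℝ) →ₗ[ℝ] (X → ℝ)) :
    𝔬.GG U ∘ₗ Fop = 𝔬.G1 U ∘ₗ Fop - (𝔬.G1 U ∘ₗ 𝔬.Dv U ∘ₗ 𝔬.R U ∘ₗ 𝔬.Dvstar U) ∘ₗ (𝔬.G1 U ∘ₗ Fop) -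
      (𝔬.G1 U ∘ₗ 𝔬.Qstar U) ∘ₗ (𝔬.C1 U ∘ₗ (𝔬.Q U ∘ₗ (𝔬.G1 U ∘ₗ Fop))) := by
  refine LinearMap.ext fun v => ?_
  simp only [LinearMap.comp_apply, LinearMap.sub_apply, hI.eq153, frakPstar_apply, map_sub]
  abel

/-! ## §2 The generic second-order block-L² lines with the middle term cut at an order-zero word -/

/-- ★★ **A SECOND-ORDER L² LINE OF 𝔊 = 𝔓G₁ WITH A GENERIC LEFT LETTER E : 𝔩(X) → 𝔩(X₃), MIDDLE TERM CUT AT D·R·D\*·G₁** (statement shape of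
`B9Thm313WholeL2GPZ.GG_l2bd_leftZ` with `hEGDv` replaced by `hV` and the bundle `Letters313L2Z` by its three coarse fields): from (3.153) re-associated
(`E_GG_eq_derivCut`), the G₁-entries EG₁, EG₁Q\*, G₁ by r1's Neumann bookkeeping from Theorem 3.3 for G₀ and the step (`entry_l2w_of_step`; inputs `hE3` =
the (3.46) line of E∘G₀ in ratio form, `hEGQs` = E∘G₀Q\*), the coarse letters `hgQs ∕ hc1 ∕ hq` (shapes of `Letters313L2PZ.gQs ∕ c1 ∕ q`), and the ORDER-ZERO
letter `hV` — ‖1_{Δ(y)}D R D\*G₁μ‖₂ ≦ B₄·(L^{j′}η∕Lʲη)·e^{−δd(y,y′)}‖μ‖₂ for supp μ ⊂ Δ(y′) —, composed by `hasMaj_frakG_classes` in the block-L² classes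
Lʲη → Lʲη, then the scale transfer (2.60) of p. 398 (`blockBd_transfer`, constant Λ): block bound `constG46 (constKp B₂ B₄ θ c) c`·Λ·e^{−(ρ−αρ₀)d(y,y′)}
between `blk` and `blk₃`; provisos ρ + 5σ ≦ δ, B₂θc² < 1.
[cite: Balaban1985BackgroundPropagators, Thm 3.13 p.426 + (3.153) p.426 + (3.46) p.398 + p.398 (remark after (3.47)); Balaban1984PropagatorsII, Lemma 2.1 (2.60)–(2.61) p.234] -/
theorem GG_l2bd_leftDerivCut (hG : GeoOK g) {𝔬 : Ops g B X Y Z W} {Lap : B.Cfg → Module.End ℝ (X → ℝ)} {U : B.Cfg}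
    {X₃ : Type} [Fintype X₃] {blk₃ : X₃ → g.Site} {E : (X → ℝ) →ₗ[ℝ] (X₃ → ℝ)}
    {B₂ B₄ θ δ ρ ρ₀ α Λ σ c : ℝ} (hrow : RowSum (toB6 g R₀ H₀) σ c) (hB₂ : 0 ≤ B₂) (hB₄ : 0 ≤ B₄) (hθ : 0 ≤ θ) (hρ : 0 ≤ ρ)
    (hσ : 0 ≤ σ) (hρδ : ρ + 5 * σ ≤ δ) (hST : ScaleTransfer g ρ₀ α Λ (fun y => g.len y ^ (1 : ℝ)))
    (hL : Thm33G0L2 𝔬 Lap R₀ H₀ B₂ δ U)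
    (hT : BlockBd (g := toB6 g R₀ H₀) 𝔬.blk 𝔬.blk (𝔬.Tpi U + 𝔬.T2 U)
      (fun (y y' : g.Site) => θ * (g.len y)⁻¹ * (g.len y')⁻¹ * Real.exp (-(δ * g.dist y y'))))
    {vZ : g.Site → ℝ} (hvZ : ∀ y, 0 < vZ y)
    (hgQs : BlockBd (g := toB6 g R₀ H₀) 𝔬.blkZ 𝔬.blk (𝔬.G0 U ∘ₗ 𝔬.Qstar U)
      (fun (y y' : g.Site) => B₄ * g.len y * (vZ y' * g.len y') * Real.exp (-(δ * g.dist y y'))))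
    (hc1 : BlockBd (g := toB6 g R₀ H₀) 𝔬.blkZ 𝔬.blkZ (𝔬.C1 U)
      (fun (y y' : g.Site) => B₄ * (vZ y * g.len y)⁻¹ * (vZ y' * g.len y')⁻¹ * Real.exp (-(δ * g.dist y y'))))
    (hq : BlockBd (g := toB6 g R₀ H₀) 𝔬.blk 𝔬.blkZ (𝔬.Q U)
      (fun (y y' : g.Site) => B₄ * (vZ y * g.len y * (g.len y')⁻¹) * Real.exp (-(δ * g.dist y y'))))
    (hE3 : BlockBd (g := toB6 g R₀ H₀) 𝔬.blk blk₃ (E ∘ₗ 𝔬.G0 U)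
      (fun (y y' : g.Site) => B₂ * ((g.len y)⁻¹ * g.len y') * Real.exp (-(δ * g.dist y y'))))
    (hEGQs : BlockBd (g := toB6 g R₀ H₀) 𝔬.blkZ blk₃ (E ∘ₗ 𝔬.G0 U ∘ₗ 𝔬.Qstar U)
      (fun (y y' : g.Site) => B₄ * ((g.len y)⁻¹ * (vZ y' * g.len y')) * Real.exp (-(δ * g.dist y y'))))
    (hV : BlockBd (g := toB6 g R₀ H₀) 𝔬.blk 𝔬.blk (𝔬.Dv U ∘ₗ 𝔬.R U ∘ₗ 𝔬.Dvstar U ∘ₗ 𝔬.G1 U)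
      (fun (y y' : g.Site) => B₄ * ((g.len y)⁻¹ * g.len y') * Real.exp (-(δ * g.dist y y'))))
    (hI : Identities 𝔬 U) (hq' : B₂ * θ * c * c < 1) :
    BlockBd (g := toB6 g R₀ H₀) 𝔬.blk blk₃ (E ∘ₗ 𝔬.GG U)
      (fun (y y' : g.Site) => constG46 (constKp B₂ B₄ θ c) c * Λ * Real.exp (-((ρ - α * ρ₀) * g.dist y y'))) := by
  -- adapted from `B9Thm313WholeL2GPZ.GG_l2bd_leftZ` (middle term (E∘G₁)∘V in place of (E∘G₁D)∘(RD*G₁))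
  have hc : 0 ≤ c ∨ IsEmpty g.Site := by
    by_cases hne : Nonempty g.Site
    · exact Or.inl (hrow.nonneg hne.some)
    · exact Or.inr (not_nonempty_iff.mp hne)
  rcases hc with hc | hemp
  swap
  · intro y' μ hμ y
    exact (hemp.false y).elim
  have htri : Triangle254 (toB6 g R₀ H₀) := fun a b c => hG.tri a b c
  have hWl : ∀ y : g.Site, 0 < (fun y : g.Site => g.len y) y := fun y => hG.lenpos y
  have hWi : ∀ y : g.Site, 0 < (fun y : g.Site => (g.len y)⁻¹) y := fun y => inv_pos.mpr (hG.lenpos y)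
  have hWv : ∀ y : g.Site, 0 < (fun y : g.Site => vZ y * g.len y) y := fun y => mul_pos (hvZ y) (hG.lenpos y)
  have hWvi : ∀ y : g.Site, 0 < (fun y : g.Site => (vZ y * g.len y)⁻¹) y := fun y => inv_pos.mpr (mul_pos (hvZ y) (hG.lenpos y))
  have hfix : 𝔬.G1 U = 𝔬.G0 U + 𝔬.G0 U ∘ₗ (𝔬.Tpi U + 𝔬.T2 U) ∘ₗ 𝔬.G1 U := fix_of_inverses hI.invG0' hI.invG1
  -- constants
  have hS0 : 0 ≤ B₂ + B₄ := add_nonneg hB₂ hB₄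
  have hS₂ : B₂ ≤ B₂ + B₄ := by linarith
  have hS₄ : B₄ ≤ B₂ + B₄ := by linarith
  obtain ⟨hKp0, -⟩ := constP_nonneg_le hθ hc hq' hS0 hS0 hS0 le_rfl le_rfl le_rfl
  obtain ⟨hP₂0, hP₂le⟩ := constP_nonneg_le hθ hc hq' hB₂ hB₂ hB₂ hS₂ hS₂ hS₂
  obtain ⟨hP₄0, hP₄le⟩ := constP_nonneg_le hθ hc hq' hB₄ hB₂ hB₄ hS₄ hS₂ hS₄
  have hB₄K : B₄ ≤ constP B₂ θ c (B₂ + B₄) (B₂ + B₄) (B₂ + B₄) := by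
    have hq1 : 0 ≤ (1 - B₂ * θ * c * c)⁻¹ := inv_nonneg.mpr (by linarith)
    have h0 : 0 ≤ (B₂ + B₄) * (θ * ((B₂ + B₄) * (1 - B₂ * θ * c * c)⁻¹) * c) * c :=
      mul_nonneg (mul_nonneg hS0 (mul_nonneg (mul_nonneg hθ (mul_nonneg hS0 hq1)) hc)) hc
    unfold constP; linarith
  have hKK0 : 0 ≤ constP B₂ θ c (B₂ + B₄) (B₂ + B₄) (B₂ + B₄) * constP B₂ θ c (B₂ + B₄) (B₂ + B₄) (B₂ + B₄) * c :=
    mul_nonneg (mul_nonneg hKp0 hKp0) hc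
  have hKG0 : 0 ≤ constG46 (constKp B₂ B₄ θ c) c := constG46_nonneg hKp0 hc
  -- rates
  have hr₁0 : 0 ≤ ρ + 3 * σ := by linarith
  have hr₁δ : ρ + 3 * σ + 2 * σ ≤ δ := by linarith
  have hr₂0 : 0 ≤ ρ + 2 * σ := by linarith
  have hr₂1 : ρ + 2 * σ ≤ ρ + 3 * σ := by linarith
  have hr₂δ' : ρ + 2 * σ + σ ≤ δ := by linarith
  have hr₂δ : ρ + 2 * σ ≤ δ := by linarith
  have hρr₂ : ρ + 2 * σ ≤ ρ + 2 * σ := le_rfl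
  -- the G₁-entries EG₁, EG₁Q*, G₁ by r1's Neumann bookkeeping, at the rate ρ + 3σ
  have pG := entry_l2w_of_step hG hWl hWl (Eop := E) (Fop := LinearMap.id) (aS := B₂) (aE := B₂) (aEF := B₂) hrow hB₂
    hθ hB₂ hB₂ hB₂ hr₁0 hσ hr₁δ hL hT (by rw [LinearMap.comp_id]; exact hL.l0.mono fun y y' => le_of_eq (by ring))
    (hE3.mono fun y y' => le_of_eq (by ring))
    (by rw [LinearMap.comp_id]; exact hE3.mono fun y y' => le_of_eq (by ring)) hfix hq'
  have pGQ := entry_l2w_of_step hG hWv hWl (Eop := E) (Fop := 𝔬.Qstar U) (aS := B₄) (aE := B₂) (aEF := B₄) hrow hB₂ hθ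
    hB₄ hB₂ hB₄ hr₁0 hσ hr₁δ hL hT (hgQs.mono fun y y' => le_of_eq (by ring)) (hE3.mono fun y y' => le_of_eq (by ring))
    (hEGQs.mono fun y y' => le_of_eq (by ring)) hfix hq'
  have pG1 := entry_l2w_of_step hG hWl hWi (Eop := LinearMap.id) (Fop := LinearMap.id) (aS := B₂) (aE := B₂) (aEF := B₂)
    hrow hB₂ hθ hB₂ hB₂ hB₂ hr₁0 hσ hr₁δ hL hT
    (by rw [LinearMap.comp_id]; exact hL.l0.mono fun y y' => le_of_eq (by ring))
    (by rw [LinearMap.id_comp]; exact hL.l0.mono fun y y' => le_of_eq (by rw [inv_inv]; ring))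
    (by rw [LinearMap.id_comp, LinearMap.comp_id]; exact hL.l0.mono fun y y' => le_of_eq (by rw [inv_inv]; ring)) hfix hq'
  rw [LinearMap.id_comp] at pG1
  -- the order-zero letter V = DRD*G₁ and the coarse letters C₁, Q in the block-L² classes
  have pV : HasMaj (l2w (toB6 g R₀ H₀) 𝔬.blk (fun y : g.Site => g.len y) fun y => (hWl y).le)
      (l2w (toB6 g R₀ H₀) 𝔬.blk (fun y : g.Site => g.len y) fun y => (hWl y).le)
      (𝔬.Dv U ∘ₗ 𝔬.R U ∘ₗ 𝔬.Dvstar U ∘ₗ 𝔬.G1 U) (fun y y' => B₄ * Real.exp (-(δ * g.dist y y'))) :=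
    hasMaj_l2w_of_blockBd_ratio (g := toB6 g R₀ H₀) hWl hWl (hV.mono fun y y' => le_of_eq (by ring))
  have pC : HasMaj (l2w (toB6 g R₀ H₀) 𝔬.blkZ (fun y : g.Site => (vZ y * g.len y)⁻¹) fun y => (hWvi y).le)
      (l2w (toB6 g R₀ H₀) 𝔬.blkZ (fun y : g.Site => vZ y * g.len y) fun y => (hWv y).le)
      (𝔬.C1 U) (fun y y' => B₄ * Real.exp (-(δ * g.dist y y'))) :=
    hasMaj_l2w_of_blockBd_ratio (g := toB6 g R₀ H₀) hWvi hWv (hc1.mono fun y y' => le_of_eq (by ring))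
  have pQ : HasMaj (l2w (toB6 g R₀ H₀) 𝔬.blk (fun y : g.Site => (g.len y)⁻¹) fun y => (hWi y).le)
      (l2w (toB6 g R₀ H₀) 𝔬.blkZ (fun y : g.Site => (vZ y * g.len y)⁻¹) fun y => (hWvi y).le)
      (𝔬.Q U) (fun y y' => B₄ * Real.exp (-(δ * g.dist y y'))) :=
    hasMaj_l2w_of_blockBd_ratio (g := toB6 g R₀ H₀) hWi hWvi (hq.mono fun y y' => le_of_eq (by rw [inv_inv]; ring))
  -- QG₁ at the rate ρ + 2σ
  have pQG := hasMaj_comp_exp htri hG.dnn hrow hB₄ hP₂0 hr₂0 hr₂1 hr₂δ' pQ pG1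
  simp only [l2w_κ, one_mul] at pQG
  -- everything at (K_p, ρ + 2σ), the composite at K_p²c
  have uG := hasMaj_up hG hP₂0 hP₂le hr₂1 pG
  have uV := hasMaj_up hG hB₄ hB₄K hr₂δ pV
  have uGQ := hasMaj_up hG hP₄0 hP₄le hr₂1 pGQ
  have uC := hasMaj_up hG hB₄ hB₄K hr₂δ pC
  have uQG := hasMaj_up hG (mul_nonneg (mul_nonneg hB₄ hP₂0) hc)
    (mul_le_mul_of_nonneg_right (mul_le_mul hB₄K hP₂le hP₂0 hKp0) hc) hρr₂ pQG
  -- (3.153) composed in the block-L² classes (middle term (E∘G₁)∘V), then unweighted and transferred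
  have hfr := hasMaj_frakG_classes htri hG.dnn hrow hKp0 hKp0 hKp0 hKp0 hKp0 hKK0 hρ hσ hρr₂ uG uG uV uGQ uC uQG
  have hGG := hfr.congr (T' := E ∘ₗ 𝔬.GG U) fun μ => by rw [E_GG_eq_derivCut hI E]
  have hbd := blockBd_of_hasMaj_l2w hGG hWl
  have h' : BlockBd (g := toB6 g R₀ H₀) 𝔬.blk blk₃ (E ∘ₗ 𝔬.GG U)
      (fun (y y' : g.Site) => constG46 (constKp B₂ B₄ θ c) c * (g.len y' ^ (1 : ℝ) * (g.len y ^ (1 : ℝ))⁻¹) *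
        Real.exp (-(ρ * g.dist y y'))) :=
    hbd.mono fun y y' => le_of_eq (by
      simp only [l2w_κ, one_mul, toB6_dist, constG46, constKp, Real.rpow_one, div_eq_mul_inv]; ring)
  exact blockBd_transfer (C := fun _ _ => constG46 (constKp B₂ B₄ θ c) c) (fun _ _ => hKG0)
    (fun z => Real.rpow_pos_of_pos (hG.lenpos z) 1) hST h'

/-- ★★ **A SECOND-ORDER L² LINE OF 𝔊 = 𝔓G₁ WITH A GENERIC RIGHT LETTER F : 𝔩(X₀) → 𝔩(X), MIDDLE TERM CUT AT G₁·D·R·D\*** (statement shape of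
`B9Thm313WholeL2GPZ.GG_l2bd_rightZ` with `hrgdF` replaced by `hV'` and the bundle `Letters313L2Z` by its three coarse fields): from (3.153) re-associated
(`GG_comp_eq_derivCut`), the G₁-entries G₁F, G₁Q\* from Theorem 3.3 for G₀ and the step (`entry_l2w_of_step`; `hF5` = the (3.46) line of G₀∘F in ratio
form), the coarse letters `hgQs ∕ hc1 ∕ hq`, and the ORDER-ZERO letter `hV'` — ‖1_{Δ(y)}G₁D R D\*f‖₂ ≦ B₄·(Lʲη∕L^{j′}η)·e^{−δd(y,y′)}‖f‖₂ for supp f ⊂ Δ(y′) —,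
composed by `hasMaj_frakG_classes` in the block-L² classes (Lʲη)⁻¹ → (Lʲη)⁻¹, then the scale transfer (2.60) at the weight (Lʲη)⁻¹ (constant Λ′): block
bound `constG46 (constKp B₂ B₄ θ c) c`·Λ′·e^{−(ρ−αρ₀)d} between `blk₀` and `blk`; provisos ρ + 5σ ≦ δ, B₂θc² < 1.
[cite: Balaban1985BackgroundPropagators, Thm 3.13 p.426 + (3.153) p.426 + (3.46) p.398 + p.398 (remark after (3.47)); Balaban1984PropagatorsII, Lemma 2.1 (2.60)–(2.61) p.234] -/
theorem GG_l2bd_rightDerivCut (hG : GeoOK g) {𝔬 : Ops g B X Y Z W} {Lap : B.Cfg → Module.End ℝ (X → ℝ)} {U : B.Cfg}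
    {X₀ : Type} [Fintype X₀] {blk₀ : X₀ → g.Site} {F : (X₀ → ℝ) →ₗ[ℝ] (X → ℝ)}
    {B₂ B₄ θ δ ρ ρ₀ α Λ σ c : ℝ} (hrow : RowSum (toB6 g R₀ H₀) σ c) (hB₂ : 0 ≤ B₂) (hB₄ : 0 ≤ B₄) (hθ : 0 ≤ θ) (hρ : 0 ≤ ρ)
    (hσ : 0 ≤ σ) (hρδ : ρ + 5 * σ ≤ δ) (hST : ScaleTransfer g ρ₀ α Λ (fun y => g.len y ^ (-1 : ℝ)))
    (hL : Thm33G0L2 𝔬 Lap R₀ H₀ B₂ δ U)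
    (hT : BlockBd (g := toB6 g R₀ H₀) 𝔬.blk 𝔬.blk (𝔬.Tpi U + 𝔬.T2 U)
      (fun (y y' : g.Site) => θ * (g.len y)⁻¹ * (g.len y')⁻¹ * Real.exp (-(δ * g.dist y y'))))
    {vZ : g.Site → ℝ} (hvZ : ∀ y, 0 < vZ y)
    (hgQs : BlockBd (g := toB6 g R₀ H₀) 𝔬.blkZ 𝔬.blk (𝔬.G0 U ∘ₗ 𝔬.Qstar U)
      (fun (y y' : g.Site) => B₄ * g.len y * (vZ y' * g.len y') * Real.exp (-(δ * g.dist y y'))))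
    (hc1 : BlockBd (g := toB6 g R₀ H₀) 𝔬.blkZ 𝔬.blkZ (𝔬.C1 U)
      (fun (y y' : g.Site) => B₄ * (vZ y * g.len y)⁻¹ * (vZ y' * g.len y')⁻¹ * Real.exp (-(δ * g.dist y y'))))
    (hq : BlockBd (g := toB6 g R₀ H₀) 𝔬.blk 𝔬.blkZ (𝔬.Q U)
      (fun (y y' : g.Site) => B₄ * (vZ y * g.len y * (g.len y')⁻¹) * Real.exp (-(δ * g.dist y y'))))
    (hF5 : BlockBd (g := toB6 g R₀ H₀) blk₀ 𝔬.blk (𝔬.G0 U ∘ₗ F)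
      (fun (y y' : g.Site) => B₂ * (g.len y * (g.len y')⁻¹) * Real.exp (-(δ * g.dist y y'))))
    (hV' : BlockBd (g := toB6 g R₀ H₀) 𝔬.blk 𝔬.blk (𝔬.G1 U ∘ₗ 𝔬.Dv U ∘ₗ 𝔬.R U ∘ₗ 𝔬.Dvstar U)
      (fun (y y' : g.Site) => B₄ * (g.len y * (g.len y')⁻¹) * Real.exp (-(δ * g.dist y y'))))
    (hI : Identities 𝔬 U) (hq' : B₂ * θ * c * c < 1) :
    BlockBd (g := toB6 g R₀ H₀) blk₀ 𝔬.blk (𝔬.GG U ∘ₗ F)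
      (fun (y y' : g.Site) => constG46 (constKp B₂ B₄ θ c) c * Λ * Real.exp (-((ρ - α * ρ₀) * g.dist y y'))) := by
  -- adapted from `B9Thm313WholeL2GPZ.GG_l2bd_rightZ` (middle term V′∘(G₁F) in place of (G₁D)∘(RD*G₁F))
  have hc : 0 ≤ c ∨ IsEmpty g.Site := by
    by_cases hne : Nonempty g.Site
    · exact Or.inl (hrow.nonneg hne.some)
    · exact Or.inr (not_nonempty_iff.mp hne)
  rcases hc with hc | hemp
  swap
  · intro y' μ hμ y
    exact (hemp.false y).elim
  have htri : Triangle254 (toB6 g R₀ H₀) := fun a b c => hG.tri a b c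
  have hWl : ∀ y : g.Site, 0 < (fun y : g.Site => g.len y) y := fun y => hG.lenpos y
  have hWi : ∀ y : g.Site, 0 < (fun y : g.Site => (g.len y)⁻¹) y := fun y => inv_pos.mpr (hG.lenpos y)
  have hWv : ∀ y : g.Site, 0 < (fun y : g.Site => vZ y * g.len y) y := fun y => mul_pos (hvZ y) (hG.lenpos y)
  have hWvi : ∀ y : g.Site, 0 < (fun y : g.Site => (vZ y * g.len y)⁻¹) y := fun y => inv_pos.mpr (mul_pos (hvZ y) (hG.lenpos y))
  have hfix : 𝔬.G1 U = 𝔬.G0 U + 𝔬.G0 U ∘ₗ (𝔬.Tpi U + 𝔬.T2 U) ∘ₗ 𝔬.G1 U := fix_of_inverses hI.invG0' hI.invG1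
  -- constants
  have hS0 : 0 ≤ B₂ + B₄ := add_nonneg hB₂ hB₄
  have hS₂ : B₂ ≤ B₂ + B₄ := by linarith
  have hS₄ : B₄ ≤ B₂ + B₄ := by linarith
  obtain ⟨hKp0, -⟩ := constP_nonneg_le hθ hc hq' hS0 hS0 hS0 le_rfl le_rfl le_rfl
  obtain ⟨hP₂0, hP₂le⟩ := constP_nonneg_le hθ hc hq' hB₂ hB₂ hB₂ hS₂ hS₂ hS₂
  obtain ⟨hP₄0, hP₄le⟩ := constP_nonneg_le hθ hc hq' hB₄ hB₂ hB₄ hS₄ hS₂ hS₄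
  have hB₄K : B₄ ≤ constP B₂ θ c (B₂ + B₄) (B₂ + B₄) (B₂ + B₄) := by
    have hq1 : 0 ≤ (1 - B₂ * θ * c * c)⁻¹ := inv_nonneg.mpr (by linarith)
    have h0 : 0 ≤ (B₂ + B₄) * (θ * ((B₂ + B₄) * (1 - B₂ * θ * c * c)⁻¹) * c) * c :=
      mul_nonneg (mul_nonneg hS0 (mul_nonneg (mul_nonneg hθ (mul_nonneg hS0 hq1)) hc)) hc
    unfold constP; linarith
  have hKK0 : 0 ≤ constP B₂ θ c (B₂ + B₄) (B₂ + B₄) (B₂ + B₄) * constP B₂ θ c (B₂ + B₄) (B₂ + B₄) (B₂ + B₄) * c :=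
    mul_nonneg (mul_nonneg hKp0 hKp0) hc
  have hKG0 : 0 ≤ constG46 (constKp B₂ B₄ θ c) c := constG46_nonneg hKp0 hc
  -- rates
  have hr₁0 : 0 ≤ ρ + 3 * σ := by linarith
  have hr₁δ : ρ + 3 * σ + 2 * σ ≤ δ := by linarith
  have hr₂0 : 0 ≤ ρ + 2 * σ := by linarith
  have hr₂1 : ρ + 2 * σ ≤ ρ + 3 * σ := by linarith
  have hr₂δ' : ρ + 2 * σ + σ ≤ δ := by linarith
  have hr₂δ : ρ + 2 * σ ≤ δ := by linarith
  have hρr₂ : ρ + 2 * σ ≤ ρ + 2 * σ := le_rfl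
  -- the G₁-entries G₁F, G₁Q* by r1's Neumann bookkeeping, at the rate ρ + 3σ
  have pG := entry_l2w_of_step hG hWi hWi (Eop := LinearMap.id) (Fop := F) (aS := B₂) (aE := B₂) (aEF := B₂) hrow hB₂
    hθ hB₂ hB₂ hB₂ hr₁0 hσ hr₁δ hL hT (hF5.mono fun y y' => le_of_eq (by ring))
    (by rw [LinearMap.id_comp]; exact hL.l0.mono fun y y' => le_of_eq (by rw [inv_inv]; ring))
    (by rw [LinearMap.id_comp]; exact hF5.mono fun y y' => le_of_eq (by rw [inv_inv]; ring)) hfix hq'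
  rw [LinearMap.id_comp] at pG
  have pGQ := entry_l2w_of_step hG hWv hWi (Eop := LinearMap.id) (Fop := 𝔬.Qstar U) (aS := B₄) (aE := B₂) (aEF := B₄) hrow
    hB₂ hθ hB₄ hB₂ hB₄ hr₁0 hσ hr₁δ hL hT (hgQs.mono fun y y' => le_of_eq (by ring))
    (by rw [LinearMap.id_comp]; exact hL.l0.mono fun y y' => le_of_eq (by rw [inv_inv]; ring))
    (by rw [LinearMap.id_comp]; exact hgQs.mono fun y y' => le_of_eq (by rw [inv_inv]; ring)) hfix hq'
  rw [LinearMap.id_comp] at pGQ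
  -- the order-zero letter V′ = G₁DRD* and the coarse letters C₁, Q in the block-L² classes
  have pV : HasMaj (l2w (toB6 g R₀ H₀) 𝔬.blk (fun y : g.Site => (g.len y)⁻¹) fun y => (hWi y).le)
      (l2w (toB6 g R₀ H₀) 𝔬.blk (fun y : g.Site => (g.len y)⁻¹) fun y => (hWi y).le)
      (𝔬.G1 U ∘ₗ 𝔬.Dv U ∘ₗ 𝔬.R U ∘ₗ 𝔬.Dvstar U) (fun y y' => B₄ * Real.exp (-(δ * g.dist y y'))) :=
    hasMaj_l2w_of_blockBd_ratio (g := toB6 g R₀ H₀) hWi hWi (hV'.mono fun y y' => le_of_eq (by rw [inv_inv]; ring))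
  have pC : HasMaj (l2w (toB6 g R₀ H₀) 𝔬.blkZ (fun y : g.Site => (vZ y * g.len y)⁻¹) fun y => (hWvi y).le)
      (l2w (toB6 g R₀ H₀) 𝔬.blkZ (fun y : g.Site => vZ y * g.len y) fun y => (hWv y).le)
      (𝔬.C1 U) (fun y y' => B₄ * Real.exp (-(δ * g.dist y y'))) :=
    hasMaj_l2w_of_blockBd_ratio (g := toB6 g R₀ H₀) hWvi hWv (hc1.mono fun y y' => le_of_eq (by ring))
  have pQ : HasMaj (l2w (toB6 g R₀ H₀) 𝔬.blk (fun y : g.Site => (g.len y)⁻¹) fun y => (hWi y).le)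
      (l2w (toB6 g R₀ H₀) 𝔬.blkZ (fun y : g.Site => (vZ y * g.len y)⁻¹) fun y => (hWvi y).le)
      (𝔬.Q U) (fun y y' => B₄ * Real.exp (-(δ * g.dist y y'))) :=
    hasMaj_l2w_of_blockBd_ratio (g := toB6 g R₀ H₀) hWi hWvi (hq.mono fun y y' => le_of_eq (by rw [inv_inv]; ring))
  -- QG₁F at the rate ρ + 2σ
  have pQG := hasMaj_comp_exp htri hG.dnn hrow hB₄ hP₂0 hr₂0 hr₂1 hr₂δ' pQ pG
  simp only [l2w_κ, one_mul] at pQG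
  -- everything at (K_p, ρ + 2σ), the composite at K_p²c
  have uG := hasMaj_up hG hP₂0 hP₂le hr₂1 pG
  have uV := hasMaj_up hG hB₄ hB₄K hr₂δ pV
  have uGQ := hasMaj_up hG hP₄0 hP₄le hr₂1 pGQ
  have uC := hasMaj_up hG hB₄ hB₄K hr₂δ pC
  have uQG := hasMaj_up hG (mul_nonneg (mul_nonneg hB₄ hP₂0) hc)
    (mul_le_mul_of_nonneg_right (mul_le_mul hB₄K hP₂le hP₂0 hKp0) hc) hρr₂ pQG
  -- (3.153) composed in the block-L² classes (middle term V′∘(G₁F)), then unweighted and transferred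
  have hfr := hasMaj_frakG_classes htri hG.dnn hrow hKp0 hKp0 hKp0 hKp0 hKp0 hKK0 hρ hσ hρr₂ uG uV uG uGQ uC uQG
  have hGG := hfr.congr (T' := 𝔬.GG U ∘ₗ F) fun μ => by rw [GG_comp_eq_derivCut hI F]
  have hbd := blockBd_of_hasMaj_l2w hGG hWi
  have h' : BlockBd (g := toB6 g R₀ H₀) blk₀ 𝔬.blk (𝔬.GG U ∘ₗ F)
      (fun (y y' : g.Site) => constG46 (constKp B₂ B₄ θ c) c * (g.len y' ^ (-1 : ℝ) * (g.len y ^ (-1 : ℝ))⁻¹) *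
        Real.exp (-(ρ * g.dist y y'))) :=
    hbd.mono fun y y' => le_of_eq (by
      simp only [l2w_κ, one_mul, toB6_dist, constG46, constKp, Real.rpow_neg_one, div_eq_mul_inv]; ring)
  exact blockBd_transfer (C := fun _ _ => constG46 (constKp B₂ B₄ θ c) c) (fun _ _ => hKG0)
    (fun z => Real.rpow_pos_of_pos (hG.lenpos z) (-1)) hST h'

/-! ## §3 The pair families (3.46)₄, (3.46)₅ of 𝔊 without the third-order pair letters -/

variable [Fintype P]

/-- ★ **(3.46)₄ FOR 𝔊 AS THE PACKAGED PAIR FAMILY ∇_{U,ν}∇_{U,μ}𝔊, NO LETTER `ddGDv`** (statement shape of `B9Thm313WholeDirL2Z.GG_l2bd_family3Z`): one model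
X → X × (P × P) with block map `blk ∘ Prod.fst`, block bound √|P × P|·`constG46 (constKp B₂ B₄ θ c) c`·Λ·e^{−(ρ−αρ₀)d(y,y′)}: `GG_l2bd_leftDerivCut` for every pair
from Theorem 3.3's pair-indexed L² bounds for G₀ (`Thm33G0L2P`, `.l3 q` = the (3.46) line of ∇_ν∇_μG₀), the pair letter `hddGQs q` (∇_ν∇_μG₀Q\*, shape of
`Letters313L2PZ.ddGQs`), the coarse letters `hgQs ∕ hc1 ∕ hq` and the order-zero letter `hV` (D∘R∘D\*∘G₁), then `blockBd_familyOp`.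
[cite: Balaban1985BackgroundPropagators, Thm 3.13 p.426 + (3.153) p.426 + (3.46) p.398 + (3.39) p.397; Balaban1984PropagatorsII, Lemma 2.1 (2.60)–(2.61) p.234] -/
theorem GG_l2bd_family3DerivCut (hG : GeoOK g) {𝔬 : Ops g B X Y Z W} {Dd Dds : B.Cfg → P → Module.End ℝ (X → ℝ)} {U : B.Cfg}
    {B₂ B₄ θ δ ρ ρ₀ α Λ σ c : ℝ} (hrow : RowSum (toB6 g R₀ H₀) σ c) (hB₂ : 0 ≤ B₂) (hB₄ : 0 ≤ B₄) (hθ : 0 ≤ θ) (hρ : 0 ≤ ρ)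
    (hσ : 0 ≤ σ) (hρδ : ρ + 5 * σ ≤ δ) (hΛ : 0 ≤ Λ) (hST : ScaleTransfer g ρ₀ α Λ (fun y => g.len y ^ (1 : ℝ)))
    (hL : Thm33G0L2P 𝔬 Dd Dds R₀ H₀ B₂ δ U)
    (hT : BlockBd (g := toB6 g R₀ H₀) 𝔬.blk 𝔬.blk (𝔬.Tpi U + 𝔬.T2 U)
      (fun (y y' : g.Site) => θ * (g.len y)⁻¹ * (g.len y')⁻¹ * Real.exp (-(δ * g.dist y y'))))
    {vZ : g.Site → ℝ} (hvZ : ∀ y, 0 < vZ y)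
    (hgQs : BlockBd (g := toB6 g R₀ H₀) 𝔬.blkZ 𝔬.blk (𝔬.G0 U ∘ₗ 𝔬.Qstar U)
      (fun (y y' : g.Site) => B₄ * g.len y * (vZ y' * g.len y') * Real.exp (-(δ * g.dist y y'))))
    (hc1 : BlockBd (g := toB6 g R₀ H₀) 𝔬.blkZ 𝔬.blkZ (𝔬.C1 U)
      (fun (y y' : g.Site) => B₄ * (vZ y * g.len y)⁻¹ * (vZ y' * g.len y')⁻¹ * Real.exp (-(δ * g.dist y y'))))
    (hq : BlockBd (g := toB6 g R₀ H₀) 𝔬.blk 𝔬.blkZ (𝔬.Q U)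
      (fun (y y' : g.Site) => B₄ * (vZ y * g.len y * (g.len y')⁻¹) * Real.exp (-(δ * g.dist y y'))))
    (hddGQs : ∀ q : P × P, BlockBd (g := toB6 g R₀ H₀) 𝔬.blkZ 𝔬.blk ((Dd U q.1 ∘ₗ Dd U q.2) ∘ₗ 𝔬.G0 U ∘ₗ 𝔬.Qstar U)
      (fun (y y' : g.Site) => B₄ * ((g.len y)⁻¹ * (vZ y' * g.len y')) * Real.exp (-(δ * g.dist y y'))))
    (hV : BlockBd (g := toB6 g R₀ H₀) 𝔬.blk 𝔬.blk (𝔬.Dv U ∘ₗ 𝔬.R U ∘ₗ 𝔬.Dvstar U ∘ₗ 𝔬.G1 U)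
      (fun (y y' : g.Site) => B₄ * ((g.len y)⁻¹ * g.len y') * Real.exp (-(δ * g.dist y y'))))
    (hI : Identities 𝔬 U) (hq' : B₂ * θ * c * c < 1) :
    BlockBd (g := toB6 g R₀ H₀) 𝔬.blk (𝔬.blk ∘ Prod.fst) (familyOp (fun q : P × P => (Dd U q.1 ∘ₗ Dd U q.2) ∘ₗ 𝔬.GG U))
      (fun (y y' : g.Site) => Real.sqrt (Fintype.card (P × P)) * (constG46 (constKp B₂ B₄ θ c) c * Λ *
        Real.exp (-((ρ - α * ρ₀) * g.dist y y')))) := by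
  have hc : 0 ≤ c ∨ IsEmpty g.Site := by
    by_cases hne : Nonempty g.Site
    · exact Or.inl (hrow.nonneg hne.some)
    · exact Or.inr (not_nonempty_iff.mp hne)
  rcases hc with hc | hemp
  swap
  · intro y' μ hμ y
    exact (hemp.false y).elim
  have hS0 : 0 ≤ B₂ + B₄ := add_nonneg hB₂ hB₄
  obtain ⟨hKp0, -⟩ := constP_nonneg_le hθ hc hq' hS0 hS0 hS0 le_rfl le_rfl le_rfl
  have hKG0 : 0 ≤ constG46 (constKp B₂ B₄ θ c) c := constG46_nonneg hKp0 hc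
  exact blockBd_familyOp (R := R₀) (H := H₀) 𝔬.blk 𝔬.blk
    (fun a b => mul_nonneg (mul_nonneg hKG0 hΛ) (Real.exp_nonneg _))
    fun q => GG_l2bd_leftDerivCut hG hrow hB₂ hB₄ hθ hρ hσ hρδ hST (Thm33G0L2P.toLap hB₂ hG.lenle hL) hT hvZ hgQs hc1 hq (hL.l3 q)
      (hddGQs q) hV hI hq'

/-- ★ **(3.46)₅ FOR 𝔊 AS THE PACKAGED PAIR FAMILY 𝔊∇\*_{U,ν}∇\*_{U,μ}, NO LETTER `rgdDds`** (statement shape of `B9Thm313WholeDirL2Z.GG_l2bd_family5Z`): one model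
X → X × (P × P) with block map `blk ∘ Prod.fst`, block bound √|P × P|·`constG46 (constKp B₂ B₄ θ c) c`·Λ′·e^{−(ρ−αρ₀)d(y,y′)}: `GG_l2bd_rightDerivCut` for every
pair from `Thm33G0L2P.l5 q` (the (3.46) line of G₀∇\*_ν∇\*_μ), the coarse letters and the order-zero letter `hV'` (G₁∘D∘R∘D\*), then `blockBd_familyOp`.
[cite: Balaban1985BackgroundPropagators, Thm 3.13 p.426 + (3.153) p.426 + (3.46) p.398 + (3.39) p.397; Balaban1984PropagatorsII, Lemma 2.1 (2.60)–(2.61) p.234] -/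
theorem GG_l2bd_family5DerivCut (hG : GeoOK g) {𝔬 : Ops g B X Y Z W} {Dd Dds : B.Cfg → P → Module.End ℝ (X → ℝ)} {U : B.Cfg}
    {B₂ B₄ θ δ ρ ρ₀ α Λ σ c : ℝ} (hrow : RowSum (toB6 g R₀ H₀) σ c) (hB₂ : 0 ≤ B₂) (hB₄ : 0 ≤ B₄) (hθ : 0 ≤ θ) (hρ : 0 ≤ ρ)
    (hσ : 0 ≤ σ) (hρδ : ρ + 5 * σ ≤ δ) (hΛ : 0 ≤ Λ) (hST : ScaleTransfer g ρ₀ α Λ (fun y => g.len y ^ (-1 : ℝ)))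
    (hL : Thm33G0L2P 𝔬 Dd Dds R₀ H₀ B₂ δ U)
    (hT : BlockBd (g := toB6 g R₀ H₀) 𝔬.blk 𝔬.blk (𝔬.Tpi U + 𝔬.T2 U)
      (fun (y y' : g.Site) => θ * (g.len y)⁻¹ * (g.len y')⁻¹ * Real.exp (-(δ * g.dist y y'))))
    {vZ : g.Site → ℝ} (hvZ : ∀ y, 0 < vZ y)
    (hgQs : BlockBd (g := toB6 g R₀ H₀) 𝔬.blkZ 𝔬.blk (𝔬.G0 U ∘ₗ 𝔬.Qstar U)
      (fun (y y' : g.Site) => B₄ * g.len y * (vZ y' * g.len y') * Real.exp (-(δ * g.dist y y'))))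
    (hc1 : BlockBd (g := toB6 g R₀ H₀) 𝔬.blkZ 𝔬.blkZ (𝔬.C1 U)
      (fun (y y' : g.Site) => B₄ * (vZ y * g.len y)⁻¹ * (vZ y' * g.len y')⁻¹ * Real.exp (-(δ * g.dist y y'))))
    (hq : BlockBd (g := toB6 g R₀ H₀) 𝔬.blk 𝔬.blkZ (𝔬.Q U)
      (fun (y y' : g.Site) => B₄ * (vZ y * g.len y * (g.len y')⁻¹) * Real.exp (-(δ * g.dist y y'))))
    (hV' : BlockBd (g := toB6 g R₀ H₀) 𝔬.blk 𝔬.blk (𝔬.G1 U ∘ₗ 𝔬.Dv U ∘ₗ 𝔬.R U ∘ₗ 𝔬.Dvstar U)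
      (fun (y y' : g.Site) => B₄ * (g.len y * (g.len y')⁻¹) * Real.exp (-(δ * g.dist y y'))))
    (hI : Identities 𝔬 U) (hq' : B₂ * θ * c * c < 1) :
    BlockBd (g := toB6 g R₀ H₀) 𝔬.blk (𝔬.blk ∘ Prod.fst) (familyOp (fun q : P × P => 𝔬.GG U ∘ₗ (Dds U q.1 ∘ₗ Dds U q.2)))
      (fun (y y' : g.Site) => Real.sqrt (Fintype.card (P × P)) * (constG46 (constKp B₂ B₄ θ c) c * Λ *
        Real.exp (-((ρ - α * ρ₀) * g.dist y y')))) := by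
  have hc : 0 ≤ c ∨ IsEmpty g.Site := by
    by_cases hne : Nonempty g.Site
    · exact Or.inl (hrow.nonneg hne.some)
    · exact Or.inr (not_nonempty_iff.mp hne)
  rcases hc with hc | hemp
  swap
  · intro y' μ hμ y
    exact (hemp.false y).elim
  have hS0 : 0 ≤ B₂ + B₄ := add_nonneg hB₂ hB₄
  obtain ⟨hKp0, -⟩ := constP_nonneg_le hθ hc hq' hS0 hS0 hS0 le_rfl le_rfl le_rfl
  have hKG0 : 0 ≤ constG46 (constKp B₂ B₄ θ c) c := constG46_nonneg hKp0 hc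
  exact blockBd_familyOp (R := R₀) (H := H₀) 𝔬.blk 𝔬.blk
    (fun a b => mul_nonneg (mul_nonneg hKG0 hΛ) (Real.exp_nonneg _))
    fun q => GG_l2bd_rightDerivCut hG hrow hB₂ hB₄ hθ hρ hσ hρδ hST (Thm33G0L2P.toLap hB₂ hG.lenle hL) hT hvZ hgQs hc1 hq (hL.l5 q)
      hV' hI hq'

end L2

end

end Literature.MathematicalPhysics.QuantumFieldTheory.Balaban1983to89.B9Thm313WholeL2DerivCut
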